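import Mathlib
import HarnessLib
import Literature.MathematicalPhysics.QuantumLattice.KohnLuttinger
import Summits.HubbardSuperconductivity.HubbardSuperconductivity.Theses.WeakCouplingBCS
import Summits.HubbardSuperconductivity.HubbardSuperconductivity.Theorems.WeakCouplingBCSWcbcsKohnLuttingerB1gMuWindow
import Summits.HubbardSuperconductivity.HubbardSuperconductivity.Theorems.ChiralWindowCwThesisUFreeAnchor
import Summits.HubbardSuperconductivity.HubbardSuperconductivity.Theorems.WeakCouplingBCSKlCertTPrimePHReflectionMeasure

/-!
# Route `WeakCouplingBCS` — the lattice-harmonic frame of the `t' = 0` Kohn–Luttinger form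
# (reader item «(KLSCAN)-HARMONIC-FRAME», certificate half of stmt-HubbardSuperconductivity-0158; helper file)

The static Lindhard function of a band `ε` is `2πℤ²`-periodic and even, `χ₀(q; μ) = Σ_{r ∈ ℤ²} w_r(μ) cos(r·q)` with
lattice Fourier coefficients `w_r(μ) = (2π)⁻² ∫_{BZ} χ₀(q; μ) cos(r·q) dq` (the real-space static bubble).  By the addition
theorem the `U²` part of the Kohn–Luttinger pairing form on `L²(σ_μ)` splits, for every finite box of harmonics, into a
FINITE-RANK separable kernel `Σ_{|r|_∞ ≤ L} w_r [cos(r·k)cos(r·k') - sin(r·k)sin(r·k')]` plus a tail (`klh_kernel_split`,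
exact, no convergence needed).  This file supplies the objects of that frame and three groups of exact facts used by the
harmonic reading of the `t' = 0` doping window:

* §1 objects (`klhPhase`, `klhWeight`, `klhCosMoment`, `klhSinMoment`, `klhDOS` = harmonic-resolved density of states
  `ρ_r(E) = (2π)⁻² ∫_{σ_E} cos(r·k) dσ_E`, `klhGram`, `klhBox`, `klhTrunc`, `klhTail`, `klhTailHS`) and the kernel split;
* §2 the particle–hole parity of the harmonic DOS at `t' = 0`, `ρ_r(-E) = (-1)^{x+y} ρ_r(E)` (`klh_dos_ph`) — transported
  along the tree's BZ-folded shift by `Q = (π, π)` (`klph_measurePreserving_shift_fermiCurveMeasure`, file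
  `…KlCertTPrimePHReflectionMeasure`); this is eq. (7) of [Saremi 2007], the input of the half-filling sign law
  `(-1)^{x+y} w_r(0) ≥ 0` (eq. (8) there, via the Laplace-square representation of `w_r`);
* §3 the `Q`-parity SELECTION RULES as exact trigonometric identities and their Fermi-curve form (`cos k₀ + cos k₁ = -μ/2`
  on `σ_μ`): the first odd-site `B2g`/`A1g` harmonics and the first even-site `B1g`/`A2g` harmonics are divisible by
  `cos k₀ + cos k₁`, hence `O(μ)` on the Fermi curve;
* §4 the instrument-independent spine: a `U = 1` level certificate with margin `γ` on any `[μ₂, μ₁] ⊂ (-4, 0)` gives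
  `Theses.WeakCouplingBCS.WcbcsKohnLuttingerB1g` (`klh_wcbcsKohnLuttingerB1g_of_levelCertificate`, from
  `chemicalPotentialOfDensity_window` and `CwThesis.leading_of_certificateOne`).

Design: auxiliary `def`s and lemmas only; no `instance`/`notation`, no new notion, no `Prop`-valued conjecture.
A Kohn–Luttinger instability statement is not ODLRO; nothing here asserts a margin or proves superconductivity.
References: S. Saremi, Phys. Rev. B 76 (2007) 184430 (arXiv:0705.0187), eqs. (5)–(10); D. J. Scalapino, E. Loh,
J. E. Hirsch, Phys. Rev. B 34 (1986) 8190 (real-space sign structure of the exchange-mediated pairing interaction);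
S. Raghu, S. A. Kivelson, D. J. Scalapino, Phys. Rev. B 81 (2010) 224505, §II.
-/

noncomputable section

-- the tree's namespace `Summit.<Summit>.<Problem>.Theorems` repeats the summit name by design (D-0017)
set_option linter.dupNamespace false

namespace Summit.HubbardSuperconductivity.HubbardSuperconductivity.Theorems

open MeasureTheory Set Real Literature.MathematicalPhysics.QuantumLattice

/-! ## §1 Objects of the harmonic frame and the kernel split -/

/-- The plane-wave phase `r · k = x k₀ + y k₁` of the lattice vector `r = (x, y) ∈ ℤ²`. -/
def klhPhase (r : ℤ × ℤ) (k : Momentum) : ℝ := (r.1 : ℝ) * k 0 + (r.2 : ℝ) * k 1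

/-- The phase is additive in the momentum. -/
theorem klh_phase_add (r : ℤ × ℤ) (k k' : Momentum) :
    klhPhase r (k + k') = klhPhase r k + klhPhase r k' := by
  have h0 : (k + k') 0 = k 0 + k' 0 := rfl
  have h1 : (k + k') 1 = k 1 + k' 1 := rfl
  simp only [klhPhase, h0, h1]
  ring

/-- `w_r(μ) = (2π)⁻² ∫_{BZ} χ₀(q; μ) cos(r·q) dq`: the `r`-th lattice Fourier coefficient of the static Lindhard
function (the real-space static particle–hole bubble). -/
def klhWeight (ε : Momentum → ℝ) (μ : ℝ) (r : ℤ × ℤ) : ℝ :=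
  (∫ q in brillouinZone, lindhardFunction ε μ q * cos (klhPhase r q)) / (2 * π) ^ 2

/-- Fermi-surface cosine moment `C_r(ψ) = ∫ ψ(k) cos(r·k) dσ_μ(k)`. -/
def klhCosMoment (ε : Momentum → ℝ) (μ : ℝ) (ψ : Momentum → ℝ) (r : ℤ × ℤ) : ℝ :=
  ∫ k, ψ k * cos (klhPhase r k) ∂fermiCurveMeasure ε μ

/-- Fermi-surface sine moment `S_r(ψ) = ∫ ψ(k) sin(r·k) dσ_μ(k)`. -/
def klhSinMoment (ε : Momentum → ℝ) (μ : ℝ) (ψ : Momentum → ℝ) (r : ℤ × ℤ) : ℝ :=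
  ∫ k, ψ k * sin (klhPhase r k) ∂fermiCurveMeasure ε μ

/-- Harmonic-resolved density of states `ρ_r(E) = (2π)⁻² ∫_{σ_E} cos(r·k) dσ_E` (`r = 0`: the density of states). -/
def klhDOS (ε : Momentum → ℝ) (E : ℝ) (r : ℤ × ℤ) : ℝ :=
  (∫ k, cos (klhPhase r k) ∂fermiCurveMeasure ε E) / (2 * π) ^ 2

/-- Gram moment of two cosine harmonics in `L²(σ_μ)`. -/
def klhGram (ε : Momentum → ℝ) (μ : ℝ) (r r' : ℤ × ℤ) : ℝ :=
  ∫ k, cos (klhPhase r k) * cos (klhPhase r' k) ∂fermiCurveMeasure ε μ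

/-- The harmonic box `{r : |x| ≤ L, |y| ≤ L}`. -/
def klhBox (L : ℕ) : Finset (ℤ × ℤ) := Finset.Icc (-(L : ℤ)) L ×ˢ Finset.Icc (-(L : ℤ)) L

/-- The degree-`L` harmonic truncation `T_L χ₀(q) = Σ_{r ∈ box L} w_r cos(r·q)`. -/
def klhTrunc (ε : Momentum → ℝ) (μ : ℝ) (L : ℕ) (q : Momentum) : ℝ :=
  ∑ r ∈ klhBox L, klhWeight ε μ r * cos (klhPhase r q)

/-- The harmonic tail `t_L = χ₀ - T_L χ₀`. -/
def klhTail (ε : Momentum → ℝ) (μ : ℝ) (L : ℕ) (q : Momentum) : ℝ :=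
  lindhardFunction ε μ q - klhTrunc ε μ L q

/-- Hilbert–Schmidt size of the tail on `L²(σ_μ) ⊗ L²(σ_μ)`: `(∫∫ t_L(k + k')² dσ_μ dσ_μ)^{1/2}`. -/
def klhTailHS (ε : Momentum → ℝ) (μ : ℝ) (L : ℕ) : ℝ :=
  Real.sqrt (∫ k, ∫ k', klhTail ε μ L (k + k') ^ 2 ∂fermiCurveMeasure ε μ ∂fermiCurveMeasure ε μ)

/-- **Kernel split.** For every `L`,
`χ₀(k + k') = Σ_{r ∈ box L} w_r [cos(r·k) cos(r·k') - sin(r·k) sin(r·k')] + t_L(k + k')`. -/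
theorem klh_kernel_split (ε : Momentum → ℝ) (μ : ℝ) (L : ℕ) (k k' : Momentum) :
    lindhardFunction ε μ (k + k') =
      (∑ r ∈ klhBox L, klhWeight ε μ r *
          (cos (klhPhase r k) * cos (klhPhase r k') - sin (klhPhase r k) * sin (klhPhase r k'))) +
        klhTail ε μ L (k + k') := by
  have h : ∀ r : ℤ × ℤ, cos (klhPhase r (k + k')) =
      cos (klhPhase r k) * cos (klhPhase r k') - sin (klhPhase r k) * sin (klhPhase r k') := by
    intro r; rw [klh_phase_add, Real.cos_add]
  unfold klhTail klhTrunc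
  simp_rw [h]
  ring

/-! ## §2 Particle–hole parity of the harmonic DOS at `t' = 0` -/

/-- The staggering sign `(-1)^{x+y}` of `r = (x, y)`. -/
def klhSign (r : ℤ × ℤ) : ℝ := (-1 : ℝ) ^ (r.1 + r.2)

/-- The staggering sign squares to one. -/
theorem klhSign_mul_self (r : ℤ × ℤ) : klhSign r * klhSign r = 1 := by
  rw [klhSign, ← zpow_add₀ (by norm_num : (-1 : ℝ) ≠ 0), Even.neg_one_zpow ⟨_, rfl⟩]

/-- Under the BZ-folded shift by `Q = (π, π)` the phase moves by `(±x ± y)π`, an integer of the parity of `x + y`. -/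
theorem klh_phase_klphShift (r : ℤ × ℤ) {k : Momentum} (hk : k ∈ brillouinZone) :
    ∃ n : ℤ, klhPhase r (klphShift k) = klhPhase r k + n * π ∧ Even (n - (r.1 + r.2)) := by
  have hk0 : k 0 ∈ Set.Ico (-π) π := hk 0
  have hk1 : k 1 ∈ Set.Ico (-π) π := hk 1
  rcases klphTau_eq_add_pi_or hk0 with h0 | h0 <;> rcases klphTau_eq_add_pi_or hk1 with h1 | h1
  · refine ⟨r.1 + r.2, ?_, ⟨0, by ring⟩⟩
    simp only [klhPhase, klphShift_apply_zero, klphShift_apply_one, h0, h1]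
    push_cast; ring
  · refine ⟨r.1 - r.2, ?_, ⟨-r.2, by ring⟩⟩
    simp only [klhPhase, klphShift_apply_zero, klphShift_apply_one, h0, h1]
    push_cast; ring
  · refine ⟨-r.1 + r.2, ?_, ⟨-r.1, by ring⟩⟩
    simp only [klhPhase, klphShift_apply_zero, klphShift_apply_one, h0, h1]
    push_cast; ring
  · refine ⟨-r.1 - r.2, ?_, ⟨-r.1 - r.2, by ring⟩⟩
    simp only [klhPhase, klphShift_apply_zero, klphShift_apply_one, h0, h1]
    push_cast; ring

/-- `cos(r·(k + Q)) = (-1)^{x+y} cos(r·k)` on the Brillouin zone (BZ-folded shift). -/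
theorem klh_cos_phase_klphShift (r : ℤ × ℤ) {k : Momentum} (hk : k ∈ brillouinZone) :
    cos (klhPhase r (klphShift k)) = klhSign r * cos (klhPhase r k) := by
  obtain ⟨n, hn, ⟨m, hm⟩⟩ := klh_phase_klphShift r hk
  rw [hn, Real.cos_add_int_mul_pi, klhSign]
  congr 1
  have : n = (r.1 + r.2) + (m + m) := by linarith
  rw [this, zpow_add₀ (by norm_num : (-1 : ℝ) ≠ 0), Even.neg_one_zpow ⟨m, rfl⟩, mul_one]

/-- **Particle–hole parity of the harmonic DOS** (`t' = 0`): `ρ_r(-E) = (-1)^{x+y} ρ_r(E)` — [Saremi 2007, eq. (7)]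
in band language, from `klph_measurePreserving_shift_fermiCurveMeasure 0 (-E)`. -/
theorem klh_dos_ph (E : ℝ) (r : ℤ × ℤ) :
    klhDOS (squareDispersion 1 0) (-E) r = klhSign r * klhDOS (squareDispersion 1 0) E r := by
  have hmp : MeasurePreserving klphShift (fermiCurveMeasure (squareDispersion 1 0) E)
      (fermiCurveMeasure (squareDispersion 1 0) (-E)) := by
    have h := klph_measurePreserving_shift_fermiCurveMeasure 0 (-E)
    simp only [neg_zero, neg_neg] at h
    exact h
  have hF : MeasurableSet (fermiCurve (squareDispersion 1 0) E) :=
    measurableSet_fermiCurve (measurable_squareDispersion 1 0) E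
  have hae : ∀ᵐ k ∂fermiCurveMeasure (squareDispersion 1 0) E, k ∈ fermiCurve (squareDispersion 1 0) E := by
    have h1 : ∀ᵐ k ∂((Measure.hausdorffMeasure 1 : Measure Momentum).restrict
        (fermiCurve (squareDispersion 1 0) E)), k ∈ fermiCurve (squareDispersion 1 0) E :=
      ae_restrict_mem hF
    unfold fermiCurveMeasure
    exact (withDensity_absolutelyContinuous _ _).ae_le h1
  have key : (∫ k, cos (klhPhase r k) ∂fermiCurveMeasure (squareDispersion 1 0) (-E)) =
      klhSign r * ∫ k, cos (klhPhase r k) ∂fermiCurveMeasure (squareDispersion 1 0) E := by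
    rw [← hmp.integral_comp klph_measurableEmbedding_shift (fun k => cos (klhPhase r k)),
      ← integral_const_mul]
    refine integral_congr_ae ?_
    filter_upwards [hae] with k hk
    exact klh_cos_phase_klphShift r (mem_fermiCurve_iff.1 hk).1
  unfold klhDOS
  rw [key, mul_div_assoc]

/-! ## §3 Selection rules: `Q`-parity and divisibility by `cos k₀ + cos k₁ = -μ/2` on `σ_μ` -/

/-- `B2g`, first odd site `r = (2,1)`: `sin 2x sin y + sin x sin 2y = 2 sin x sin y (cos x + cos y)`. -/
theorem klh_selRule_B2g_21 (x y : ℝ) :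
    sin (2 * x) * sin y + sin x * sin (2 * y) = 2 * sin x * sin y * (cos x + cos y) := by
  rw [Real.sin_two_mul, Real.sin_two_mul]; ring

/-- `A1g`, odd site `r = (2,1)`: `cos 2x cos y + cos x cos 2y = (cos x + cos y)(2 cos x cos y - 1)`. -/
theorem klh_selRule_A1g_21 (x y : ℝ) :
    cos (2 * x) * cos y + cos x * cos (2 * y) = (cos x + cos y) * (2 * cos x * cos y - 1) := by
  rw [Real.cos_two_mul, Real.cos_two_mul]; ring

/-- `A1g`, odd site `r = (3,0)`: `cos 3x + cos 3y = (cos x + cos y)(4cos²x - 4 cos x cos y + 4cos²y - 3)`. -/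
theorem klh_selRule_A1g_30 (x y : ℝ) :
    cos (3 * x) + cos (3 * y) =
      (cos x + cos y) * (4 * cos x ^ 2 - 4 * cos x * cos y + 4 * cos y ^ 2 - 3) := by
  rw [Real.cos_three_mul, Real.cos_three_mul]; ring

/-- `B1g`, first even site `r = (2,0)`: `cos 2x - cos 2y = 2 (cos x - cos y)(cos x + cos y)`. -/
theorem klh_selRule_B1g_20 (x y : ℝ) :
    cos (2 * x) - cos (2 * y) = 2 * (cos x - cos y) * (cos x + cos y) := by
  rw [Real.cos_two_mul, Real.cos_two_mul]; ring

/-- `A2g`, first even site `r = (3,1)`: `sin 3x sin y - sin x sin 3y = 4 sin x sin y (cos x - cos y)(cos x + cos y)`. -/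
theorem klh_selRule_A2g_31 (x y : ℝ) :
    sin (3 * x) * sin y - sin x * sin (3 * y) =
      4 * sin x * sin y * (cos x - cos y) * (cos x + cos y) := by
  rw [Real.sin_three_mul, Real.sin_three_mul]
  linear_combination (-4 * sin x * sin y) * Real.sin_sq_add_cos_sq x +
    (4 * sin x * sin y) * Real.sin_sq_add_cos_sq y

/-- On the `t' = 0` Fermi curve, `cos k₀ + cos k₁ = -μ/2`. -/
theorem klh_cos_add_cos_of_mem_fermiCurve {μ : ℝ} {k : Momentum}
    (hk : k ∈ fermiCurve (squareDispersion 1 0) μ) : cos (k 0) + cos (k 1) = -μ / 2 := by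
  have h := (mem_fermiCurve_iff.1 hk).2
  simp only [squareDispersion] at h
  linarith

/-- The `B2g` rule on the Fermi curve: the first odd-site `B2g` harmonic equals `-μ sin k₀ sin k₁` there. -/
theorem klh_selRule_B2g_21_fermiCurve {μ : ℝ} {k : Momentum}
    (hk : k ∈ fermiCurve (squareDispersion 1 0) μ) :
    sin (2 * k 0) * sin (k 1) + sin (k 0) * sin (2 * k 1) = -μ * (sin (k 0) * sin (k 1)) := by
  rw [klh_selRule_B2g_21, klh_cos_add_cos_of_mem_fermiCurve hk]; ring

/-- The `A1g` rule on the Fermi curve (`r = (2,1)`). -/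
theorem klh_selRule_A1g_21_fermiCurve {μ : ℝ} {k : Momentum}
    (hk : k ∈ fermiCurve (squareDispersion 1 0) μ) :
    cos (2 * k 0) * cos (k 1) + cos (k 0) * cos (2 * k 1) =
      (-μ / 2) * (2 * cos (k 0) * cos (k 1) - 1) := by
  rw [klh_selRule_A1g_21, klh_cos_add_cos_of_mem_fermiCurve hk]

/-- The `B1g` even-site rule on the Fermi curve (`r = (2,0)`): `cos 2k₀ - cos 2k₁ = -μ (cos k₀ - cos k₁)`. -/
theorem klh_selRule_B1g_20_fermiCurve {μ : ℝ} {k : Momentum}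
    (hk : k ∈ fermiCurve (squareDispersion 1 0) μ) :
    cos (2 * k 0) - cos (2 * k 1) = -μ * (cos (k 0) - cos (k 1)) := by
  rw [klh_selRule_B1g_20, klh_cos_add_cos_of_mem_fermiCurve hk]; ring

/-! ## §4 The instrument-independent spine to the route item -/

/-- **Spine.** A `U = 1` level certificate with margin `γ > 0` on any chemical-potential interval
`[μ₂, μ₁] ⊂ (-4, 0)` gives `WcbcsKohnLuttingerB1g` as typed (doping window `[1 - n(μ₁), 1 - n(μ₂)]`, `U₁ = 1`). -/
theorem klh_wcbcsKohnLuttingerB1g_of_levelCertificate {μ₁ μ₂ γ : ℝ}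
    (h4 : -4 < μ₂) (h12 : μ₂ < μ₁) (h0 : μ₁ < 0) (hγ : 0 < γ)
    (hcert : ∀ μ ∈ Set.Icc μ₂ μ₁, ∀ χ : D4Irrep, χ ≠ D4Irrep.B1g →
      channelInf (squareDispersion 1 0) μ 1 D4Irrep.B1g + γ ≤ channelInf (squareDispersion 1 0) μ 1 χ) :
    Theses.WeakCouplingBCS.WcbcsKohnLuttingerB1g := by
  obtain ⟨ha, hab, hb, hwin⟩ := chemicalPotentialOfDensity_window h4 h12 h0
  refine ⟨_, _, γ, 1, ha, hab, hb, hγ, one_pos, ?_⟩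
  intro δ hδ U hU χ hχ
  have hμ := hwin δ hδ
  have hμ' : chemicalPotentialOfDensity (squareDispersion 1 0) (1 - δ) ∈ Set.Ioo (-4 : ℝ) 0 :=
    ⟨lt_of_lt_of_le h4 hμ.1, lt_of_le_of_lt hμ.2 h0⟩
  exact CwThesis.leading_of_certificateOne hμ' (hcert _ hμ) U hU χ hχ

end Summit.HubbardSuperconductivity.HubbardSuperconductivity.Theorems

end
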